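import Mathlib
import Summits.Ventures.PercRepro2.K5Theorem
import Summits.Ventures.PercRepro2.HubBernstein
import Summits.Ventures.PercRepro2.PMK5Kernel
import Summits.Ventures.PercRepro2.PMK5KernelA
import Summits.Ventures.PercRepro2.PMK5Bridge
import Summits.Ventures.PercRepro2.PMK5Theorem
import Summits.Ventures.PercRepro2.PMK5Typed
import Summits.Ventures.PercRepro2.PMK5Strict
import Summits.Ventures.PercRepro2.PMK5Locus

/-!
# THE EQUALITY LOCUS OF THE WEIGHTED (PM) ON FIVE-VERTEX BASES — THE ZERO SIDE, PART 1: every coefficient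
supported inside a degenerate face vanishes (blind cell PercRepro2, mine-2 g23; the companion of `PMK5Locus.lean`;
row 2′BETA1; the face theorems and the two «iff»s are in `PMK5LocusZero.lean`)

`PMK5Locus.lean` proves the positive side: on every NON-degenerate edge set `m ⊆ K₅` (`RuleB m = false`) the
cleared typed bracket `β₁` is strictly positive at every weight vector interior on `m`.  This file proves the
zero side in the kernel: on every DEGENERATE edge set (`RuleB m = true`) `β₁` vanishes identically on the face
(`beta1_K5_zero_of_face`), so that the equality locus is EXACTLY the degenerate placements — the two «iff»s
`beta1_K5_pos_iff` («`β₁ > 0` on the whole open face ⟺ not degenerate») and `beta1_K5_zero_iff`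
(«`β₁ ≡ 0` on the face ⟺ degenerate»).

Mechanism.  Every class sum `c_k = cntPosB k − cntNegB k` supported inside `m` is a class sum of the tables
RESTRICTED to the configurations inside `m` (`restr`, `cnt3_restr_eq`: a triple of profile `k` lives inside
`supp k`), and the Kronecker numbers of the restricted tables (`kPosLm` … `kNegAm`, the `kron`-products of
`PMK5Kernel` / `PMK5KernelA` with restricted tables) carry them digitwise (`kPosLm_eq` …).  The degenerate
masks form a down-set with FIVE maximal elements `Mx = {184, 503, 637, 926, 1011}` (`coverZ`, one
`decide +kernel`: every degenerate `m` lies inside one of them), and on each of the five the positive and the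
negative restricted numbers are EQUAL for `L`, `H` and `A` (`face184` … `face1011`, five `decide +kernel` —
equal numbers have equal digits, `eq_of_kron_eq`), whence every `c_k` with `supp k ⊆ m` is `0`
(`coef_eq_of_face`); the Bernstein basis functions with support outside `m` vanish on the face, so
`β₁ = Σ_k bern_k c_k = 0` there.  Standard axioms.
-/

namespace Summit.Ventures.PercRepro2

open Hub

namespace K5

namespace PM

/-! ## Tables restricted to a face, and their Kronecker numbers -/

/-- A configuration inside the edge set `m` (a bitmask over the ten edges). -/
def inFace (m : ℕ) (ω : Fin 10 → Bool) : Bool :=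
  decide (∀ e : Fin 10, ω e = true → m.testBit e = true)

/-- The table `T` restricted to the configurations inside `m`. -/
def restr (m : ℕ) (T : (Fin 10 → Bool) → Bool) : (Fin 10 → Bool) → Bool :=
  fun ω => inFace m ω && T ω

/-- A Kronecker triple product. -/
def kp (T₁ T₂ T₃ : (Fin 10 → Bool) → Bool) : ℕ := kron T₁ * kron T₂ * kron T₃

/-- A Kronecker triple product carries the triple counts digitwise. -/
lemma kp_eq (T₁ T₂ T₃ : (Fin 10 → Bool) → Bool) :
    kp T₁ T₂ T₃ = ∑ k, cnt3 T₁ T₂ T₃ k * KB ^ idx4 k := by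
  unfold kp
  rw [kron_eq_kronSum, kron_eq_kronSum, kron_eq_kronSum, kronSum_mul_mul]

/-- The positive part of the cleared `(HALF-PM⁺)_L` on the face `m` (`kPosL` with restricted tables). -/
def kPosLm (m : ℕ) : ℕ := kp (restr m tQBLHuoU) (restr m tQ) (restr m tQ) +
  kp (restr m tQBL) (restr m tQHu) (restr m tQoU) + kp (restr m tQBL) (restr m tQHo) (restr m tQ)
/-- The negative part of the cleared `(HALF-PM⁺)_L` on the face `m`. -/
def kNegLm (m : ℕ) : ℕ := kp (restr m tQBL) (restr m tQHuoU) (restr m tQ) +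
  kp (restr m tQoU) (restr m tQ) (restr m tQBLHu) + kp (restr m tQ) (restr m tQ) (restr m tQBLHo)
/-- The positive part of the cleared `(HALF-PM⁺)_H` on the face `m`. -/
def kPosHm (m : ℕ) : ℕ := kp (restr m tQBLuoU) (restr m tQ) (restr m tQ) +
  kp (restr m tQB) (restr m tQLu) (restr m tQoU) + kp (restr m tQB) (restr m tQLo) (restr m tQ)
/-- The negative part of the cleared `(HALF-PM⁺)_H` on the face `m`. -/
def kNegHm (m : ℕ) : ℕ := kp (restr m tQB) (restr m tQLuoU) (restr m tQ) +
  kp (restr m tQoU) (restr m tQ) (restr m tQBLu) + kp (restr m tQ) (restr m tQ) (restr m tQBLo)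
/-- The positive part of the cleared `A` on the face `m`. -/
def kPosAm (m : ℕ) : ℕ := kp (restr m tQuU) (restr m tQ) (restr m tQBLHo) +
  kp (restr m tQuU) (restr m tQ) (restr m tQBLo) + kp (restr m tQ) (restr m tQBL) (restr m tQHo) +
  kp (restr m tQ) (restr m tQB) (restr m tQLo)
/-- The negative part of the cleared `A` on the face `m`. -/
def kNegAm (m : ℕ) : ℕ := kp (restr m tQuU) (restr m tQBL) (restr m tQHo) +
  kp (restr m tQuU) (restr m tQB) (restr m tQLo) + kp (restr m tQ) (restr m tQ) (restr m tQBLHo) +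
  kp (restr m tQ) (restr m tQ) (restr m tQBLo)

/-- The positive triple counts of `(HALF-PM⁺)_L` on the face `m`. -/
def cntPosLm (m : ℕ) (k : Fin 10 → Fin 4) : ℕ := cnt3 (restr m tQBLHuoU) (restr m tQ) (restr m tQ) k +
  cnt3 (restr m tQBL) (restr m tQHu) (restr m tQoU) k + cnt3 (restr m tQBL) (restr m tQHo) (restr m tQ) k
/-- The negative triple counts of `(HALF-PM⁺)_L` on the face `m`. -/
def cntNegLm (m : ℕ) (k : Fin 10 → Fin 4) : ℕ := cnt3 (restr m tQBL) (restr m tQHuoU) (restr m tQ) k +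
  cnt3 (restr m tQoU) (restr m tQ) (restr m tQBLHu) k + cnt3 (restr m tQ) (restr m tQ) (restr m tQBLHo) k
/-- The positive triple counts of `(HALF-PM⁺)_H` on the face `m`. -/
def cntPosHm (m : ℕ) (k : Fin 10 → Fin 4) : ℕ := cnt3 (restr m tQBLuoU) (restr m tQ) (restr m tQ) k +
  cnt3 (restr m tQB) (restr m tQLu) (restr m tQoU) k + cnt3 (restr m tQB) (restr m tQLo) (restr m tQ) k
/-- The negative triple counts of `(HALF-PM⁺)_H` on the face `m`. -/
def cntNegHm (m : ℕ) (k : Fin 10 → Fin 4) : ℕ := cnt3 (restr m tQB) (restr m tQLuoU) (restr m tQ) k +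
  cnt3 (restr m tQoU) (restr m tQ) (restr m tQBLu) k + cnt3 (restr m tQ) (restr m tQ) (restr m tQBLo) k
/-- The positive triple counts of `A` on the face `m`. -/
def cntPosAm (m : ℕ) (k : Fin 10 → Fin 4) : ℕ := cnt3 (restr m tQuU) (restr m tQ) (restr m tQBLHo) k +
  cnt3 (restr m tQuU) (restr m tQ) (restr m tQBLo) k + cnt3 (restr m tQ) (restr m tQBL) (restr m tQHo) k +
  cnt3 (restr m tQ) (restr m tQB) (restr m tQLo) k
/-- The negative triple counts of `A` on the face `m`. -/
def cntNegAm (m : ℕ) (k : Fin 10 → Fin 4) : ℕ := cnt3 (restr m tQuU) (restr m tQBL) (restr m tQHo) k +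
  cnt3 (restr m tQuU) (restr m tQB) (restr m tQLo) k + cnt3 (restr m tQ) (restr m tQ) (restr m tQBLHo) k +
  cnt3 (restr m tQ) (restr m tQ) (restr m tQBLo) k

/-- `kPosLm` carries the restricted positive counts. -/
lemma kPosLm_eq (m : ℕ) : kPosLm m = ∑ k, cntPosLm m k * KB ^ idx4 k := by
  unfold kPosLm cntPosLm
  simp only [kp_eq]
  exact sum_add_add_mul5 _ _ _
/-- `kNegLm` carries the restricted negative counts. -/
lemma kNegLm_eq (m : ℕ) : kNegLm m = ∑ k, cntNegLm m k * KB ^ idx4 k := by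
  unfold kNegLm cntNegLm
  simp only [kp_eq]
  exact sum_add_add_mul5 _ _ _
/-- `kPosHm` carries the restricted positive counts. -/
lemma kPosHm_eq (m : ℕ) : kPosHm m = ∑ k, cntPosHm m k * KB ^ idx4 k := by
  unfold kPosHm cntPosHm
  simp only [kp_eq]
  exact sum_add_add_mul5 _ _ _
/-- `kNegHm` carries the restricted negative counts. -/
lemma kNegHm_eq (m : ℕ) : kNegHm m = ∑ k, cntNegHm m k * KB ^ idx4 k := by
  unfold kNegHm cntNegHm
  simp only [kp_eq]
  exact sum_add_add_mul5 _ _ _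
/-- `kPosAm` carries the restricted positive counts. -/
lemma kPosAm_eq (m : ℕ) : kPosAm m = ∑ k, cntPosAm m k * KB ^ idx4 k := by
  unfold kPosAm cntPosAm
  simp only [kp_eq]
  exact sum_add4_mul5 _ _ _ _
/-- `kNegAm` carries the restricted negative counts. -/
lemma kNegAm_eq (m : ℕ) : kNegAm m = ∑ k, cntNegAm m k * KB ^ idx4 k := by
  unfold kNegAm cntNegAm
  simp only [kp_eq]
  exact sum_add4_mul5 _ _ _ _

/-- The restricted counts are Kronecker digits (`3 · 3^10 < 2^19`). -/
lemma cntPosLm_lt (m : ℕ) (k : Fin 10 → Fin 4) : cntPosLm m k < 2 ^ 19 := by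
  unfold cntPosLm
  have := cnt3_le (restr m tQBLHuoU) (restr m tQ) (restr m tQ) k
  have := cnt3_le (restr m tQBL) (restr m tQHu) (restr m tQoU) k
  have := cnt3_le (restr m tQBL) (restr m tQHo) (restr m tQ) k
  omega
/-- The restricted counts are Kronecker digits. -/
lemma cntNegLm_lt (m : ℕ) (k : Fin 10 → Fin 4) : cntNegLm m k < 2 ^ 19 := by
  unfold cntNegLm
  have := cnt3_le (restr m tQBL) (restr m tQHuoU) (restr m tQ) k
  have := cnt3_le (restr m tQoU) (restr m tQ) (restr m tQBLHu) k
  have := cnt3_le (restr m tQ) (restr m tQ) (restr m tQBLHo) k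
  omega
/-- The restricted counts are Kronecker digits. -/
lemma cntPosHm_lt (m : ℕ) (k : Fin 10 → Fin 4) : cntPosHm m k < 2 ^ 19 := by
  unfold cntPosHm
  have := cnt3_le (restr m tQBLuoU) (restr m tQ) (restr m tQ) k
  have := cnt3_le (restr m tQB) (restr m tQLu) (restr m tQoU) k
  have := cnt3_le (restr m tQB) (restr m tQLo) (restr m tQ) k
  omega
/-- The restricted counts are Kronecker digits. -/
lemma cntNegHm_lt (m : ℕ) (k : Fin 10 → Fin 4) : cntNegHm m k < 2 ^ 19 := by
  unfold cntNegHm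
  have := cnt3_le (restr m tQB) (restr m tQLuoU) (restr m tQ) k
  have := cnt3_le (restr m tQoU) (restr m tQ) (restr m tQBLu) k
  have := cnt3_le (restr m tQ) (restr m tQ) (restr m tQBLo) k
  omega
/-- The restricted counts are Kronecker digits (`4 · 3^10 < 2^19`). -/
lemma cntPosAm_lt (m : ℕ) (k : Fin 10 → Fin 4) : cntPosAm m k < 2 ^ 19 := by
  unfold cntPosAm
  have := cnt3_le (restr m tQuU) (restr m tQ) (restr m tQBLHo) k
  have := cnt3_le (restr m tQuU) (restr m tQ) (restr m tQBLo) k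
  have := cnt3_le (restr m tQ) (restr m tQBL) (restr m tQHo) k
  have := cnt3_le (restr m tQ) (restr m tQB) (restr m tQLo) k
  omega
/-- The restricted counts are Kronecker digits. -/
lemma cntNegAm_lt (m : ℕ) (k : Fin 10 → Fin 4) : cntNegAm m k < 2 ^ 19 := by
  unfold cntNegAm
  have := cnt3_le (restr m tQuU) (restr m tQBL) (restr m tQHo) k
  have := cnt3_le (restr m tQuU) (restr m tQB) (restr m tQLo) k
  have := cnt3_le (restr m tQ) (restr m tQ) (restr m tQBLHo) k
  have := cnt3_le (restr m tQ) (restr m tQ) (restr m tQBLo) k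
  omega

/-! ## The five maximal degenerate faces (kernel) -/

set_option maxRecDepth 100000 in
/-- The restricted kernel numbers agree on the face `184`: every class sum supported inside it vanishes. -/
theorem face184 : kPosLm 184 = kNegLm 184 ∧ kPosHm 184 = kNegHm 184 ∧ kPosAm 184 = kNegAm 184 := by
  decide +kernel

set_option maxRecDepth 100000 in
/-- The restricted kernel numbers agree on the face `503`: every class sum supported inside it vanishes. -/
theorem face503 : kPosLm 503 = kNegLm 503 ∧ kPosHm 503 = kNegHm 503 ∧ kPosAm 503 = kNegAm 503 := by
  decide +kernel

set_option maxRecDepth 100000 in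
/-- The restricted kernel numbers agree on the face `637`: every class sum supported inside it vanishes. -/
theorem face637 : kPosLm 637 = kNegLm 637 ∧ kPosHm 637 = kNegHm 637 ∧ kPosAm 637 = kNegAm 637 := by
  decide +kernel

set_option maxRecDepth 100000 in
/-- The restricted kernel numbers agree on the face `926`: every class sum supported inside it vanishes. -/
theorem face926 : kPosLm 926 = kNegLm 926 ∧ kPosHm 926 = kNegHm 926 ∧ kPosAm 926 = kNegAm 926 := by
  decide +kernel

set_option maxRecDepth 100000 in
/-- The restricted kernel numbers agree on the face `1011`: every class sum supported inside it vanishes. -/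
theorem face1011 : kPosLm 1011 = kNegLm 1011 ∧ kPosHm 1011 = kNegHm 1011 ∧ kPosAm 1011 = kNegAm 1011 := by
  decide +kernel

/-! ## Equal Kronecker numbers have equal digits; restricted counts are the counts on the face -/

/-- **Equal Kronecker numbers have equal digits**: if `P = Σ_k a k KB^{idx4 k}`, `M = Σ_k b k KB^{idx4 k}`
with `a, b < 2^19` and `P = M`, then `a k = b k` for every profile. -/
theorem eq_of_kron_eq (a b : (Fin 10 → Fin 4) → ℕ) (ha : ∀ k, a k < 2 ^ 19) (hb : ∀ k, b k < 2 ^ 19)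
    {P M : ℕ} (hP : P = ∑ k, a k * KB ^ idx4 k) (hM : M = ∑ k, b k * KB ^ idx4 k) (h : P = M)
    (k : Fin 10 → Fin 4) : a k = b k := by
  have hKB : 2 ≤ KB := by rw [KB_eq]; norm_num
  have h19 : (2 : ℕ) ^ 19 < KB := by rw [KB_eq]; norm_num
  have hj : idx4 k < 4 ^ 10 := lt_of_lt_of_eq (idx4_lt k) (by norm_num)
  have hPa : P / KB ^ idx4 k % KB = a (decode4 (idx4 k)) := by
    rw [hP, sum_profiles_eq]
    exact digit_sum hKB (fun j => a (decode4 j)) (4 ^ 10) (fun j _ => (ha _).trans h19) _ hj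
  have hMb : M / KB ^ idx4 k % KB = b (decode4 (idx4 k)) := by
    rw [hM, sum_profiles_eq]
    exact digit_sum hKB (fun j => b (decode4 j)) (4 ^ 10) (fun j _ => (hb _).trans h19) _ hj
  rw [decode4_idx4] at hPa hMb
  rw [← hPa, ← hMb, h]

set_option maxRecDepth 10000 in
/-- A triple of profile `k` lives inside the support of `k`: the restricted and the unrestricted triple counts
agree on every profile supported inside `m`. -/
lemma cnt3_restr_eq {m : ℕ} {T₁ T₂ T₃ : (Fin 10 → Bool) → Bool} {k : Fin 10 → Fin 4}
    (hk : ∀ e : Fin 10, k e ≠ 0 → m.testBit e = true) :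
    cnt3 (restr m T₁) (restr m T₂) (restr m T₃) k = cnt3 T₁ T₂ T₃ k := by
  unfold cnt3
  refine Finset.sum_congr rfl fun t ht => ?_
  rw [Finset.mem_filter] at ht
  have key : ∀ e, (t.1 e = true ∨ t.2.1 e = true ∨ t.2.2 e = true) → k e ≠ 0 := by
    intro e he h0
    have h := congrArg (fun f : Fin 10 → Fin 4 => (f e : ℕ)) ht.2
    simp only [prof_apply, h0, Fin.val_zero] at h
    rcases he with he | he | he <;> simp [he] at h
  have hin : ∀ w : Fin 10 → Bool, (∀ e, w e = true → k e ≠ 0) → inFace m w = true := fun w hw => by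
    unfold inFace
    exact decide_eq_true_iff.2 fun e he => hk e (hw e he)
  have e1 : restr m T₁ t.1 = T₁ t.1 := by
    unfold restr; rw [hin t.1 fun e he => key e (Or.inl he), Bool.true_and]
  have e2 : restr m T₂ t.2.1 = T₂ t.2.1 := by
    unfold restr; rw [hin t.2.1 fun e he => key e (Or.inr (Or.inl he)), Bool.true_and]
  have e3 : restr m T₃ t.2.2 = T₃ t.2.2 := by
    unfold restr; rw [hin t.2.2 fun e he => key e (Or.inr (Or.inr he)), Bool.true_and]
  rw [e1, e2, e3]

/-- **Every coefficient supported inside a face with equal restricted numbers vanishes.** -/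
theorem coef_eq_of_face (m : ℕ) (hz : kPosLm m = kNegLm m ∧ kPosHm m = kNegHm m ∧ kPosAm m = kNegAm m)
    (k : Fin 10 → Fin 4) (hk : ∀ e : Fin 10, k e ≠ 0 → m.testBit e = true) : cntPosB k = cntNegB k := by
  have hL := eq_of_kron_eq _ _ (cntPosLm_lt m) (cntNegLm_lt m) (kPosLm_eq m) (kNegLm_eq m) hz.1 k
  have hH := eq_of_kron_eq _ _ (cntPosHm_lt m) (cntNegHm_lt m) (kPosHm_eq m) (kNegHm_eq m) hz.2.1 k
  have hA := eq_of_kron_eq _ _ (cntPosAm_lt m) (cntNegAm_lt m) (kPosAm_eq m) (kNegAm_eq m) hz.2.2 k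
  unfold cntPosLm cntNegLm at hL
  unfold cntPosHm cntNegHm at hH
  unfold cntPosAm cntNegAm at hA
  simp only [cnt3_restr_eq hk] at hL hH hA
  unfold cntPosB cntNegB cntPosL cntNegL cntPosH cntNegH cntPosA cntNegA
  omega

/-! ## The five maximal degenerate masks cover the degenerate ones -/

/-- The five maximal degenerate edge sets (`{04 12 13 23}`, `K₅ − {04, 34}`, `K₅ − {02, 23, 24}`,
`K₅ − {01, 13, 14}`, `K₅ − {03, 04}`). -/
def Mx : Fin 5 → ℕ := ![184, 503, 637, 926, 1011]

set_option maxRecDepth 100000 in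
/-- **Every degenerate edge set lies inside one of the five maximal ones.** -/
theorem coverZ : ∀ m : Fin 1024, RuleB m = true →
    ∃ i : Fin 5, ∀ e : Fin 10, (m : ℕ).testBit e = true → (Mx i).testBit e = true := by
  decide +kernel

/-- The restricted numbers agree on each of the five maximal degenerate faces. -/
theorem faceZero_all : ∀ i : Fin 5,
    kPosLm (Mx i) = kNegLm (Mx i) ∧ kPosHm (Mx i) = kNegHm (Mx i) ∧ kPosAm (Mx i) = kNegAm (Mx i) := by
  intro i
  fin_cases i
  exacts [face184, face503, face637, face926, face1011]

end PM

end K5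

end Summit.Ventures.PercRepro2
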